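import Mathlib.Analysis.SpecialFunctions.Pow.Real
import Mathlib.Analysis.SpecialFunctions.Log.Basic
import Mathlib.Analysis.SpecialFunctions.Sqrt
import Literature.Computability.QuantumComplexity.Factoring
import Literature.NumberTheory.LFunctions.MertensElementary
import HarnessLib

/-!
# Lenstra–Pomerance 1992: the `L_N[1/2, 1 + o(1)]` calculus

Companion of `Literature/Computability/QuantumComplexity/Factoring.lean`, whose named fact
`lenstra_pomerance` (pqc.S08) renders the main theorem of H. W. Lenstra Jr. and C. Pomerance,
*A rigorous time bound for factoring integers*, J. Amer. Math. Soc. **5** (1992) 483–516 — the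
unnumbered **Theorem** of §1 (p. 483), proved in §10 as Theorem 10.5 (Algorithm 10.4) from
Theorem 10.3 (Algorithm 10.1, the class group relations method), in the probabilistic model of §12
(coin flips of unit cost, time in bit operations, expectation over the coins for each fixed input).
Everything here is PROVED; the file is the analytic glue that any assembly of `lenstra_pomerance`
(or of `NFSConjecture`-shaped statements) from per-stage bounds needs:

* the junk values announced in the module docstring of `Factoring.lean`: `Lfun a c N = 1` for
  `N ≤ 1`, `a ≠ 0` (`Lfun_eq_one_of_le_one`) and `Lfun (1/2) c 2 = 1` (`Lfun_half_two`: Mathlib's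
  real power of the negative base `log log 2` at exponent `1/2` is `exp (…) · cos (π/2) = 0`);
* the closed form `Lfun (1/2) c N = exp (c · √(log N · log log N))` for `N ≥ 3`
  (`Lfun_half_eq_exp_sqrt`; `1 < log 3` is reused from `MertensElementary.lean`) and monotonicity in
  `c` (`Lfun_half_le_Lfun_half`);
* the **absorption lemma** `exists_tendsto_mul_log_pow_mul_Lfun_le`: for `ε → 0`, `C` and `k`
  there is `ε' → 0` with `C · (log N)^k · L_N[1/2, 1 + ε N] ≤ L_N[1/2, 1 + ε' N]` for all `N ≥ 3`,
  i.e. constant and polylogarithmic factors — `O(1)` independent repetitions, machine-simulation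
  overheads, pre- and post-processing in time `(log N)^{O(1)}` — are swallowed by the `o(1)` of the
  exponent. This is the form in which "`(log n)^{O(1)} · L_n[1/2, 1 + o(1)] = L_n[1/2, 1 + o(1)]`"
  is used throughout §10 of the paper (proof of Theorem 10.3: "this is absorbed in the upper
  bound"; proof of Theorem 10.5: at most `64 · log n` expected applications of Algorithm 10.1).

Not here: the algorithmic content of the paper (Theorems 3.1, 4.1/4.5, 6.1, 7.1–7.4, 8.1, 9.1,
10.3), which would have to be vendored as named facts or implemented on Mathlib's `TM2`; the
discharge `lenstra_pomerance_holds` is out of reach of the present library (see the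
literature-prover notes of unit `provefact-…QuantumComplexi-e7252c576c`).

## References

* H. W. Lenstra Jr., C. Pomerance, *A rigorous time bound for factoring integers*, J. Amer. Math.
  Soc. 5 (1992) 483–516: §1 (definition of `L_x[a, b]` for `x > e`, Theorem, p. 483); §10
  (Theorem 10.3 p. 507, Theorem 10.5 p. 510); §12 (pp. 513–514). [LenstraPomerance1992]
-/

noncomputable section

namespace Literature.Computability.QuantumComplexity

open Complexity _root_.Computability Filter Real
open scoped Topology

/-! ### The `L`-calculus at `a = 1/2` -/

/-- For `N ≤ 1` the `L`-function takes the junk value `1`: `log N = 0`, and `0 ^ a = 0` for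
`a ≠ 0`. [cite: LenstraPomerance1992, §1 (definition of L, stated for x > e)] -/
theorem Lfun_eq_one_of_le_one {a : ℝ} (ha : a ≠ 0) (c : ℝ) {N : ℕ} (hN : N ≤ 1) :
    Lfun a c N = 1 := by
  unfold Lfun
  have hlog : Real.log (N : ℝ) = 0 := by
    interval_cases N <;> simp
  rw [hlog, Real.zero_rpow ha, mul_zero, zero_mul, Real.exp_zero]

/-- `0 < log 2 < 1`, hence `log (log 2) < 0`. [folklore] -/
theorem log_log_two_neg : Real.log (Real.log 2) < 0 := by
  have h2 : Real.log 2 < 1 := by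
    rw [Real.log_lt_iff_lt_exp (by norm_num)]
    have := Real.add_one_lt_exp (one_ne_zero)
    linarith
  exact Real.log_neg (Real.log_pos (by norm_num)) h2

/-- For `N = 2` and `a = 1/2` the `L`-function is the junk value `1`: `log log 2 < 0` and Mathlib's
real power of a negative base gives `(log log 2) ^ (1/2) = exp (…) · cos (π/2) = 0`.
[cite: LenstraPomerance1992, §1 (definition of L, stated for x > e)] -/
theorem Lfun_half_two (c : ℝ) : Lfun (1 / 2) c 2 = 1 := by
  unfold Lfun
  have h : Real.log (Real.log ((2 : ℕ) : ℝ)) ^ (1 - 1 / 2 : ℝ) = 0 := by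
    rw [Nat.cast_ofNat, Real.rpow_def_of_neg log_log_two_neg]
    have : (1 - 1 / 2 : ℝ) * Real.pi = Real.pi / 2 := by ring
    rw [this, Real.cos_pi_div_two, mul_zero]
  rw [h, mul_zero, Real.exp_zero]

/-- `L`-values are positive (they are exponentials). [folklore] -/
theorem Lfun_pos (a c : ℝ) (N : ℕ) : 0 < Lfun a c N := Real.exp_pos _

/-- For `N ≥ 3`: `0 < log N`, in fact `1 < log N` (from `1 < log 3`, the tree's
`Literature.NumberTheory.LFunctions.MertensBound.one_lt_log_three`). [folklore] -/
theorem one_lt_log_natCast {N : ℕ} (hN : 3 ≤ N) : 1 < Real.log (N : ℝ) :=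
  Literature.NumberTheory.LFunctions.MertensBound.one_lt_log_three.trans_le
    (Real.log_le_log (by norm_num) (by exact_mod_cast hN))

/-- For `N ≥ 3`: `0 < log (log N)`. [folklore] -/
theorem log_log_natCast_pos {N : ℕ} (hN : 3 ≤ N) : 0 < Real.log (Real.log (N : ℝ)) :=
  Real.log_pos (one_lt_log_natCast hN)

/-- Closed form at `a = 1/2` away from the junk range: for `N ≥ 3`,
`L_N[1/2, c] = exp (c · √(log N · log log N))`. [cite: LenstraPomerance1992, §1] -/
theorem Lfun_half_eq_exp_sqrt (c : ℝ) {N : ℕ} (hN : 3 ≤ N) :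
    Lfun (1 / 2) c N = Real.exp (c * Real.sqrt (Real.log N * Real.log (Real.log N))) := by
  unfold Lfun
  have h1 : (1 - 1 / 2 : ℝ) = 1 / 2 := by norm_num
  have hl0 : 0 ≤ Real.log (N : ℝ) := (zero_lt_one.trans (one_lt_log_natCast hN)).le
  rw [h1, Real.sqrt_eq_rpow, Real.mul_rpow hl0 (log_log_natCast_pos hN).le, mul_assoc]

/-- Monotonicity of `L_N[1/2, c]` in `c` for `N ≥ 3`. [folklore] -/
theorem Lfun_half_le_Lfun_half {N : ℕ} (hN : 3 ≤ N) {c c' : ℝ} (h : c ≤ c') :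
    Lfun (1 / 2) c N ≤ Lfun (1 / 2) c' N := by
  rw [Lfun_half_eq_exp_sqrt c hN, Lfun_half_eq_exp_sqrt c' hN, Real.exp_le_exp]
  exact mul_le_mul_of_nonneg_right h (Real.sqrt_nonneg _)

/-- The exponent scale `s N = √(log N · log log N)` is positive for `N ≥ 3`. [folklore] -/
theorem sqrt_log_mul_log_log_pos {N : ℕ} (hN : 3 ≤ N) :
    0 < Real.sqrt (Real.log N * Real.log (Real.log N)) :=
  Real.sqrt_pos.2 (mul_pos (zero_lt_one.trans (one_lt_log_natCast hN)) (log_log_natCast_pos hN))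

/-- `√(log N · log log N) → ∞` along the naturals. [folklore] -/
theorem tendsto_sqrt_log_mul_log_log_atTop :
    Tendsto (fun N : ℕ => Real.sqrt (Real.log N * Real.log (Real.log N))) atTop atTop := by
  have hlog : Tendsto (fun N : ℕ => Real.log (N : ℝ)) atTop atTop :=
    Real.tendsto_log_atTop.comp tendsto_natCast_atTop_atTop
  have hloglog : Tendsto (fun N : ℕ => Real.log (Real.log (N : ℝ))) atTop atTop :=
    Real.tendsto_log_atTop.comp hlog
  have hprod : Tendsto (fun N : ℕ => Real.log N * Real.log (Real.log N)) atTop atTop :=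
    hlog.atTop_mul_atTop₀ hloglog
  exact (Real.tendsto_sqrt_atTop).comp hprod

/-- `log log N / √(log N · log log N) → 0` along the naturals (it equals `√(log log N / log N)`
for `N ≥ 3`, and `log y / y → 0`). [folklore] -/
theorem tendsto_log_log_div_sqrt_atTop :
    Tendsto (fun N : ℕ => Real.log (Real.log N) / Real.sqrt (Real.log N * Real.log (Real.log N)))
      atTop (𝓝 0) := by
  have hlog : Tendsto (fun N : ℕ => Real.log (N : ℝ)) atTop atTop :=
    Real.tendsto_log_atTop.comp tendsto_natCast_atTop_atTop
  -- `log y / y → 0` as `y → ∞`, composed with `y = log N`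
  have hratio : Tendsto (fun N : ℕ => Real.log (Real.log (N : ℝ)) / Real.log (N : ℝ))
      atTop (𝓝 0) := by
    have h := (Real.tendsto_pow_log_div_mul_add_atTop 1 0 1 one_ne_zero).comp hlog
    refine h.congr' (Eventually.of_forall fun N => ?_)
    simp
  have hsqrt : Tendsto (fun N : ℕ => Real.sqrt (Real.log (Real.log (N : ℝ)) / Real.log (N : ℝ)))
      atTop (𝓝 0) := by
    simpa using hratio.sqrt
  refine hsqrt.congr' ?_
  filter_upwards [eventually_ge_atTop 3] with N hN
  have hl : 0 < Real.log (N : ℝ) := zero_lt_one.trans (one_lt_log_natCast hN)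
  have hll : 0 < Real.log (Real.log (N : ℝ)) := log_log_natCast_pos hN
  rw [Real.sqrt_div' _ hl.le, div_eq_div_iff (Real.sqrt_pos.2 hl).ne'
    (Real.sqrt_pos.2 (mul_pos hl hll)).ne', Real.sqrt_mul hl.le]
  have h := Real.mul_self_sqrt hll.le
  calc Real.sqrt (Real.log (Real.log N)) * (Real.sqrt (Real.log N) * Real.sqrt (Real.log (Real.log N)))
        = (Real.sqrt (Real.log (Real.log N)) * Real.sqrt (Real.log (Real.log N))) * Real.sqrt (Real.log N) := by
          ring
    _ = Real.log (Real.log N) * Real.sqrt (Real.log N) := by rw [h]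

/-- **Absorption lemma.** Constant and polylogarithmic factors are swallowed by the `o(1)` in
`L_N[1/2, 1 + o(1)]`: for every `ε → 0`, every `C` and every `k` there is `ε' → 0` with
`C · (log N)^k · L_N[1/2, 1 + ε N] ≤ L_N[1/2, 1 + ε' N]` for all `N ≥ 3`. (For `C > 0` one may take
`ε' N = ε N + (log C + k · log log N) / √(log N · log log N)`, with equality.) This is the form in
which "time `(log n)^{O(1)} · L_n[1/2, 1 + o(1)] = L_n[1/2, 1 + o(1)]`" is used throughout §10 of
the paper. [cite: LenstraPomerance1992, §10 (proof of Theorem 10.3, "absorbed in the upper bound")] -/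
theorem exists_tendsto_mul_log_pow_mul_Lfun_le (ε : ℕ → ℝ) (hε : Tendsto ε atTop (𝓝 0))
    (C : ℝ) (k : ℕ) :
    ∃ ε' : ℕ → ℝ, Tendsto ε' atTop (𝓝 0) ∧
      ∀ N : ℕ, 3 ≤ N →
        C * Real.log N ^ k * Lfun (1 / 2) (1 + ε N) N ≤ Lfun (1 / 2) (1 + ε' N) N := by
  by_cases hC : C ≤ 0
  · refine ⟨ε, hε, fun N hN => ?_⟩
    have hl0 : 0 ≤ Real.log (N : ℝ) := (zero_lt_one.trans (one_lt_log_natCast hN)).le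
    have h1 : C * Real.log N ^ k ≤ 0 := mul_nonpos_of_nonpos_of_nonneg hC (pow_nonneg hl0 k)
    exact (mul_nonpos_of_nonpos_of_nonneg h1 (Lfun_pos _ _ _).le).trans (Lfun_pos _ _ _).le
  rw [not_le] at hC
  set s : ℕ → ℝ := fun N => Real.sqrt (Real.log N * Real.log (Real.log N)) with hs
  refine ⟨fun N => ε N + (Real.log C + k * Real.log (Real.log N)) / s N, ?_, fun N hN => ?_⟩
  · -- the correction term tends to `0`
    rw [← add_zero (0 : ℝ)]
    refine hε.add ?_
    have h1 : Tendsto (fun N : ℕ => Real.log C / s N) atTop (𝓝 0) :=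
      tendsto_const_nhds.div_atTop tendsto_sqrt_log_mul_log_log_atTop
    have h2 : Tendsto (fun N : ℕ => (k : ℝ) * (Real.log (Real.log N) / s N)) atTop (𝓝 0) := by
      simpa using tendsto_log_log_div_sqrt_atTop.const_mul (k : ℝ)
    have h12 := h1.add h2
    rw [add_zero] at h12
    refine h12.congr' (Eventually.of_forall fun N => ?_)
    simp only [hs]
    ring
  · -- the inequality (an equality, in fact) for `N ≥ 3`
    have hspos : 0 < s N := sqrt_log_mul_log_log_pos hN
    have hl : 0 < Real.log (N : ℝ) := zero_lt_one.trans (one_lt_log_natCast hN)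
    rw [Lfun_half_eq_exp_sqrt _ hN, Lfun_half_eq_exp_sqrt _ hN]
    have hCk : C * Real.log N ^ k = Real.exp (Real.log C + k * Real.log (Real.log N)) := by
      rw [Real.exp_add, Real.exp_log hC, ← Real.log_pow, Real.exp_log (pow_pos hl k)]
    rw [hCk, ← Real.exp_add, Real.exp_le_exp]
    have : (1 + (ε N + (Real.log C + ↑k * Real.log (Real.log ↑N)) / s N)) * s N
        = Real.log C + ↑k * Real.log (Real.log ↑N) + (1 + ε N) * s N := by
      field_simp
      ring
    rw [show Real.sqrt (Real.log ↑N * Real.log (Real.log ↑N)) = s N from rfl, this]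

end Literature.Computability.QuantumComplexity

end
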